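import Literature.MathematicalPhysics.QuantumManyBody.PeriodicWeightedFormClosable
import HarnessLib

/-!
# The form domain of `-∑ⱼΔⱼ + W` for an abstract weight: Rellich compactness of the embedding

Topic `Literature/MathematicalPhysics/QuantumManyBody`, sequel of `PeriodicWeightedFormClosable.lean`;
abstract-weight twin of the last part of `PeriodicFormDomain.lean` (same statements and proofs with
`periodicInteraction v L ↦ W`). The embedding `ι = formEmbedW : Q → L²((ℝ/ℤ)^{3N})` is the operator-norm
limit of its finite-rank Fourier truncations `truncEmbedW R = ∑_{n ∈ F_R} ⟪eₙ, ι ·⟫ eₙ` (`lowFreq`), with the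
tail bound `‖ι ξ - T_R ι ξ‖ ≤ (L/2π(R+1)) ‖ξ‖` from the spectral kinetic energy; hence
`isCompactOperator_formEmbedW` (the Hamiltonian `-∑ⱼΔⱼ + W` has compact resolvent,
[ReedSimonIV1978, Thm. XIII.64 and XIII.73–74]). The `W`-independent Bessel identities and the box `lowFreq`
are imported from the pair file.

## References
* [ReedSimonIV1978] Reed–Simon IV, Thm. XIII.64, XIII.73–XIII.74 (periodic `-Δ` has compact resolvent).
-/

noncomputable section

open MeasureTheory Filter Set WithLp Complex UnitAddTorus
open scoped ENNReal NNReal Topology ComplexConjugate InnerProductSpace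

namespace Literature.MathematicalPhysics.QuantumManyBody.BoseGas

-- The measure on `ℝ/ℤ` is the Haar PROBABILITY measure, as in `PeriodicFormDomain.lean`.
attribute [local instance] formDomain_measureSpace formDomain_isProbabilityMeasure formDomain_isProbabilityMeasure_pi

variable {N : ℕ} {L : ℝ} {W : Config N → ℝ≥0∞}

/-- Local notation for the Hilbert space `H = L²((ℝ/ℤ)^{3N})`. -/
local notation "L2T " N':max => Lp ℂ 2 (volume : Measure (UnitAddTorus (Fin N' × Fin 3)))

/-! ### Rellich: the embedding `ι` is a compact operator -/


/-- **The Fourier truncations of the embedding**: `T_R ξ = ∑_{n ∈ F_R} ⟪e_n, ι ξ⟫ e_n`, finite-rank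
continuous linear maps `Q → L²((ℝ/ℤ)^{3N})`. [folklore] -/
def truncEmbedW (hL : 0 < L) (hWm : Measurable W) (hW : ∫⁻ X in cellN N L, W X ≠ ⊤)
    (R : ℕ) : formDomainW hL hWm hW →L[ℂ] L2T N :=
  ∑ n ∈ lowFreq N R, (ContinuousLinearMap.toSpanSingleton ℂ (mFourierLp 2 n : L2T N)) ∘L
    ((innerSL ℂ (mFourierLp 2 n : L2T N)) ∘L formEmbedW hL hWm hW)

/-- `T_R ξ = ∑_{n ∈ F_R} ⟪e_n, ι ξ⟫ e_n`. [folklore] -/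
theorem truncEmbedW_apply (hL : 0 < L) (hWm : Measurable W) (hW : ∫⁻ X in cellN N L, W X ≠ ⊤)
    (R : ℕ) (ξ : formDomainW hL hWm hW) :
    truncEmbedW hL hWm hW R ξ =
      ∑ n ∈ lowFreq N R, ⟪(mFourierLp 2 n : L2T N), formEmbedW hL hWm hW ξ⟫_ℂ • (mFourierLp 2 n : L2T N) := by
  unfold truncEmbedW
  refine (_root_.sum_apply ..).trans (Finset.sum_congr rfl fun n _ => ?_)
  simp only [ContinuousLinearMap.comp_apply, innerSL_apply_apply, ContinuousLinearMap.toSpanSingleton_apply]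

/-- The truncations are compact operators (finite rank). [folklore] -/
theorem isCompactOperator_truncEmbedW (hL : 0 < L) (hWm : Measurable W)
    (hW : ∫⁻ X in cellN N L, W X ≠ ⊤) (R : ℕ) :
    IsCompactOperator (truncEmbedW hL hWm hW R) := by
  unfold truncEmbedW
  refine Finset.induction_on (motive := fun F : Finset (Fin N × Fin 3 → ℤ) => IsCompactOperator
    (⇑(∑ n ∈ F, (ContinuousLinearMap.toSpanSingleton ℂ (mFourierLp 2 n : L2T N)) ∘L
      ((innerSL ℂ (mFourierLp 2 n : L2T N)) ∘L formEmbedW hL hWm hW)))) (lowFreq N R) ?_ ?_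
  · simp only [Finset.sum_empty]
    exact isCompactOperator_zero
  · intro a F ha ih
    rw [Finset.sum_insert ha]
    refine IsCompactOperator.add ?_ ih
    exact (isCompactOperator_of_locallyCompactSpace_dom
      ((innerSL ℂ (mFourierLp 2 a : L2T N)) ∘L formEmbedW hL hWm hW)).clm_comp
        (ContinuousLinearMap.toSpanSingleton ℂ (mFourierLp 2 a : L2T N))

/-- **The tail estimate** (the quantitative Rellich bound on the core): for a core function,
`‖ι(graphEmbedW Ψ) - T_R ι(graphEmbedW Ψ)‖ ≤ (L/(2π(R+1))) ‖graphEmbedW Ψ‖`, because the squared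
left-hand side is `L^{3N} ∑_{n ∉ F_R} |ĉₙ(Ψ)|² ≤ L^{3N}(L/(2π(R+1)))² ∑ₙ (4π²|n|²/L²)|ĉₙ(Ψ)|²
= (L/(2π(R+1)))² ∫ |∇Ψ|²`. [cite: ReedSimonIV1978, Thm. XIII.73–74 (periodic `-Δ` has compact resolvent)] -/
theorem norm_formEmbedW_sub_truncEmbedW_le_core (hL : 0 < L) (hWm : Measurable W)
    (hW : ∫⁻ X in cellN N L, W X ≠ ⊤) (R : ℕ) (Ψ : periodicCore N L) :
    ‖formEmbedW hL hWm hW ⟨graphEmbedW hL hWm hW Ψ, graphEmbedW_mem_formDomainW hL hWm hW Ψ⟩ -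
        truncEmbedW hL hWm hW R ⟨graphEmbedW hL hWm hW Ψ, graphEmbedW_mem_formDomainW hL hWm hW Ψ⟩‖ ≤
      L / (2 * Real.pi * (R + 1)) * ‖graphEmbedW hL hWm hW Ψ‖ := by
  have hΨ : ContDiff ℝ 1 (Ψ : Config N → ℂ) := Ψ.2.1
  have hper : IsTorusPeriodic L (Ψ : Config N → ℂ) := Ψ.2.2.1
  set f : L2T N := formEmbedW hL hWm hW ⟨graphEmbedW hL hWm hW Ψ, graphEmbedW_mem_formDomainW hL hWm hW Ψ⟩ with hf
  have hfval : f = compLpW hL hWm hW hΨ (Sum.inl ()) := rfl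
  set c : ℝ := L / (2 * Real.pi * (R + 1)) with hc
  have hc0 : 0 ≤ c := by positivity
  -- Step 1: the squared distance is the tail sum of the Fourier coefficients
  have hsq : ‖f - truncEmbedW hL hWm hW R ⟨graphEmbedW hL hWm hW Ψ, graphEmbedW_mem_formDomainW hL hWm hW Ψ⟩‖ ^ 2 =
      ∑' m, if m ∈ lowFreq N R then (0 : ℝ) else ‖⟪(mFourierLp 2 m : L2T N), f⟫_ℂ‖ ^ 2 := by
    rw [truncEmbedW_apply, ← hf]
    have := norm_sub_sum_inner_smul_sq (mFourierBasis (d := Fin N × Fin 3)) (lowFreq N R) f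
    rw [coe_mFourierBasis] at this
    exact this
  -- Step 2: pass to `ℝ≥0∞` and bound each tail term by the weighted term
  have hcoef : ∀ m, ‖⟪(mFourierLp 2 m : L2T N), f⟫_ℂ‖ ^ 2 =
      cellScale N L ^ 2 * ‖configFourierCoeff L (Ψ : Config N → ℂ) m‖ ^ 2 := fun m => by
    rw [hfval, inner_mFourierLp_compLpW_val, norm_mul, mul_pow, Complex.norm_real,
      Real.norm_of_nonneg (cellScale_nonneg N L)]
  have hterm : ∀ m, ENNReal.ofReal (if m ∈ lowFreq N R then (0 : ℝ) else ‖⟪(mFourierLp 2 m : L2T N), f⟫_ℂ‖ ^ 2) ≤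
      ENNReal.ofReal (cellScale N L ^ 2 * c ^ 2) *
        (ENNReal.ofReal (∑ p, (2 * Real.pi * (m p) / L) ^ 2) *
          ((‖configFourierCoeff L (Ψ : Config N → ℂ) m‖₊ : ℝ≥0∞)) ^ 2) := fun m => by
    split_ifs with hm
    · simp
    · rw [hcoef, coe_nnnorm_sq_eq_ofReal, ← ENNReal.ofReal_mul (by positivity),
        ← ENNReal.ofReal_mul (by positivity)]
      refine ENNReal.ofReal_le_ofReal ?_
      have hlow := sq_le_sum_sq_of_not_mem_lowFreq hm
      have hsum : ∑ p, (2 * Real.pi * (m p) / L) ^ 2 = (2 * Real.pi / L) ^ 2 * ∑ p, ((m p : ℝ)) ^ 2 := by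
        rw [Finset.mul_sum]; refine Finset.sum_congr rfl fun p _ => by ring
      rw [hsum]
      have h1 : 1 ≤ c ^ 2 * ((2 * Real.pi / L) ^ 2 * ∑ p, ((m p : ℝ)) ^ 2) := by
        have : c ^ 2 * ((2 * Real.pi / L) ^ 2 * ((R : ℝ) + 1) ^ 2) = 1 := by
          rw [hc]; field_simp
        rw [← this]
        gcongr
      calc cellScale N L ^ 2 * ‖configFourierCoeff L (Ψ : Config N → ℂ) m‖ ^ 2
          = cellScale N L ^ 2 * ‖configFourierCoeff L (Ψ : Config N → ℂ) m‖ ^ 2 * 1 := by ring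
        _ ≤ cellScale N L ^ 2 * ‖configFourierCoeff L (Ψ : Config N → ℂ) m‖ ^ 2 *
            (c ^ 2 * ((2 * Real.pi / L) ^ 2 * ∑ p, ((m p : ℝ)) ^ 2)) := by gcongr
        _ = cellScale N L ^ 2 * c ^ 2 * ((2 * Real.pi / L) ^ 2 * (∑ p, ((m p : ℝ)) ^ 2) *
            ‖configFourierCoeff L (Ψ : Config N → ℂ) m‖ ^ 2) := by ring
  -- Step 3: sum, and use the spectral kinetic energy
  have hsummable : Summable fun m => if m ∈ lowFreq N R then (0 : ℝ) else ‖⟪(mFourierLp 2 m : L2T N), f⟫_ℂ‖ ^ 2 := by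
    have := (hasSum_norm_sub_sum_inner_smul_sq (mFourierBasis (d := Fin N × Fin 3)) (lowFreq N R) f).summable
    rw [coe_mFourierBasis] at this
    exact this
  have hE : ENNReal.ofReal (‖f - truncEmbedW hL hWm hW R ⟨graphEmbedW hL hWm hW Ψ, graphEmbedW_mem_formDomainW hL hWm hW Ψ⟩‖ ^ 2)
      ≤ ENNReal.ofReal (c ^ 2 * ‖graphEmbedW hL hWm hW Ψ‖ ^ 2) := by
    rw [hsq, ENNReal.ofReal_tsum_of_nonneg (fun m => by positivity) hsummable]
    calc ∑' m, ENNReal.ofReal (if m ∈ lowFreq N R then (0 : ℝ) else ‖⟪(mFourierLp 2 m : L2T N), f⟫_ℂ‖ ^ 2)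
        ≤ ∑' m, ENNReal.ofReal (cellScale N L ^ 2 * c ^ 2) *
          (ENNReal.ofReal (∑ p, (2 * Real.pi * (m p) / L) ^ 2) *
            ((‖configFourierCoeff L (Ψ : Config N → ℂ) m‖₊ : ℝ≥0∞)) ^ 2) := ENNReal.tsum_le_tsum hterm
      _ = ENNReal.ofReal (cellScale N L ^ 2 * c ^ 2) *
          (((ENNReal.ofReal L ^ 3)⁻¹) ^ N * ∫⁻ X in cellN N L, kineticDensity (Ψ : Config N → ℂ) X) := by
          rw [ENNReal.tsum_mul_left, tsum_sq_mul_sq_configFourierCoeff hL hΨ hper]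
      _ = ENNReal.ofReal (c ^ 2) * ∫⁻ X in cellN N L, kineticDensity (Ψ : Config N → ℂ) X := by
          rw [mul_comm (cellScale N L ^ 2), ENNReal.ofReal_mul (by positivity), mul_assoc,
            ← mul_assoc (ENNReal.ofReal (cellScale N L ^ 2)), cellScale_sq hL.le,
            ← ofReal_inv_pow_three_pow hL, ← ENNReal.ofReal_mul (by positivity), ← mul_pow,
            mul_inv_cancel₀ (pow_ne_zero 3 hL.ne'), one_pow, ENNReal.ofReal_one, one_mul]
      _ ≤ ENNReal.ofReal (c ^ 2) * ENNReal.ofReal (‖graphEmbedW hL hWm hW Ψ‖ ^ 2) := by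
          gcongr
          rw [norm_graphEmbedW_sq, ENNReal.ofReal_add ENNReal.toReal_nonneg ENNReal.toReal_nonneg,
            ENNReal.ofReal_toReal (lintegral_energyW_lt_top hWm hW hΨ).ne]
          calc ∫⁻ X in cellN N L, kineticDensity (Ψ : Config N → ℂ) X
              ≤ ∫⁻ X in cellN N L, kineticDensity (Ψ : Config N → ℂ) X +
                  W X * ((‖(Ψ : Config N → ℂ) X‖₊ : ℝ≥0∞)) ^ 2 :=
                lintegral_mono fun X => le_self_add
            _ ≤ _ := le_add_self
      _ = ENNReal.ofReal (c ^ 2 * ‖graphEmbedW hL hWm hW Ψ‖ ^ 2) := by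
          rw [← ENNReal.ofReal_mul (by positivity)]
  -- Step 4: back to real numbers
  have hreal : ‖f - truncEmbedW hL hWm hW R ⟨graphEmbedW hL hWm hW Ψ, graphEmbedW_mem_formDomainW hL hWm hW Ψ⟩‖ ^ 2 ≤
      (c * ‖graphEmbedW hL hWm hW Ψ‖) ^ 2 := by
    rw [mul_pow]
    exact (ENNReal.ofReal_le_ofReal_iff (by positivity)).1 hE
  exact (pow_le_pow_iff_left₀ (norm_nonneg _) (by positivity) two_ne_zero).1 hreal

/-- **The Rellich bound on the form domain**: `‖ι ξ - T_R ι ξ‖ ≤ (L/(2π(R+1))) ‖ξ‖_Q` for every `ξ ∈ Q`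
(from the core by density and continuity). [cite: ReedSimonIV1978, Thm. XIII.64] -/
theorem norm_formEmbedW_sub_truncEmbedW_le (hL : 0 < L) (hWm : Measurable W)
    (hW : ∫⁻ X in cellN N L, W X ≠ ⊤) (R : ℕ) (ξ : formDomainW hL hWm hW) :
    ‖formEmbedW hL hWm hW ξ - truncEmbedW hL hWm hW R ξ‖ ≤ L / (2 * Real.pi * (R + 1)) * ‖ξ‖ := by
  have hclosed : IsClosed {ξ : formDomainW hL hWm hW |
      ‖formEmbedW hL hWm hW ξ - truncEmbedW hL hWm hW R ξ‖ ≤ L / (2 * Real.pi * (R + 1)) * ‖ξ‖} :=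
    isClosed_le (((formEmbedW hL hWm hW).continuous.sub (truncEmbedW hL hWm hW R).continuous).norm)
      (continuous_const.mul continuous_norm)
  have hsub : (coreRangeW hL hWm hW : Set (formDomainW hL hWm hW)) ⊆ {ξ : formDomainW hL hWm hW |
      ‖formEmbedW hL hWm hW ξ - truncEmbedW hL hWm hW R ξ‖ ≤ L / (2 * Real.pi * (R + 1)) * ‖ξ‖} := by
    rintro ξ ⟨Ψ, hΨ⟩
    have hξ : ξ = ⟨graphEmbedW hL hWm hW Ψ, graphEmbedW_mem_formDomainW hL hWm hW Ψ⟩ := Subtype.ext hΨ.symm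
    rw [Set.mem_setOf_eq, hξ]
    exact norm_formEmbedW_sub_truncEmbedW_le_core hL hWm hW R Ψ
  have h := closure_minimal hsub hclosed
  rw [(dense_coreRangeW hL hWm hW).closure_eq] at h
  exact h (Set.mem_univ ξ)

/-- The operator-norm form of the Rellich bound: `‖T_R - ι‖ ≤ L/(2π(R+1))`. [folklore] -/
theorem opNorm_truncEmbedW_sub_formEmbedW_le (hL : 0 < L) (hWm : Measurable W)
    (hW : ∫⁻ X in cellN N L, W X ≠ ⊤) (R : ℕ) :
    ‖truncEmbedW hL hWm hW R - formEmbedW hL hWm hW‖ ≤ L / (2 * Real.pi * (R + 1)) :=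
  ContinuousLinearMap.opNorm_le_bound _ (by positivity) fun ξ => by
    have : (truncEmbedW hL hWm hW R - formEmbedW hL hWm hW) ξ =
        truncEmbedW hL hWm hW R ξ - formEmbedW hL hWm hW ξ := rfl
    rw [this, norm_sub_rev]
    exact norm_formEmbedW_sub_truncEmbedW_le hL hWm hW R ξ

/-- The finite-rank truncations converge to the embedding in operator norm. [folklore] -/
theorem tendsto_truncEmbedW (hL : 0 < L) (hWm : Measurable W)
    (hW : ∫⁻ X in cellN N L, W X ≠ ⊤) :
    Tendsto (fun R => truncEmbedW hL hWm hW R) atTop (𝓝 (formEmbedW hL hWm hW)) := by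
  refine (tendsto_iff_norm_sub_tendsto_zero (f := fun R => truncEmbedW hL hWm hW R)
    (b := formEmbedW hL hWm hW)).2 ?_
  refine squeeze_zero (g := fun R : ℕ => L / (2 * Real.pi * (R + 1)))
    (fun R => norm_nonneg (truncEmbedW hL hWm hW R - formEmbedW hL hWm hW)) (fun R => ?_) ?_
  · exact opNorm_truncEmbedW_sub_formEmbedW_le hL hWm hW R
  · have h := (tendsto_one_div_add_atTop_nhds_zero_nat (𝕜 := ℝ)).const_mul (L / (2 * Real.pi))
    rw [mul_zero] at h
    refine h.congr fun R => ?_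
    rw [mul_one_div, div_div]

/-- **Rellich's lemma for the periodic `N`-body form: the embedding `ι : Q → L²((ℝ/ℤ)^{3N})` is a
compact operator** (the Hamiltonian has compact resolvent): `ι` is the operator-norm limit of the
finite-rank truncations `T_R`. [cite: ReedSimonIV1978, Thm. XIII.64 and XIII.73–74] -/
theorem isCompactOperator_formEmbedW (hL : 0 < L) (hWm : Measurable W)
    (hW : ∫⁻ X in cellN N L, W X ≠ ⊤) :
    IsCompactOperator (formEmbedW hL hWm hW) :=
  isCompactOperator_of_tendsto (tendsto_truncEmbedW hL hWm hW)
    (Eventually.of_forall fun R => isCompactOperator_truncEmbedW hL hWm hW R)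
end Literature.MathematicalPhysics.QuantumManyBody.BoseGas

end
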